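import Summits.KontsevichZagierPeriods.KontsevichZagierPeriods.Theses.ComplexOrientations

/-!
# `OrientationKernelOfSubs` (stmt-KontsevichZagierPeriods-18007, route ComplexOrientations, rev 4)

The ASSEMBLY of the BC2 redirect of the route's target (crux-strategist
`cstrat-stmt-KontsevichZagierPeriods-11367-r1`, 2026-08-17):
`KZDimTwo → ReductionToDimensionTwo → OrientationKernel`. Given an additive subgroup `R` of
`KZ.FormalRep` with `KZ.relations ≤ R` (whatever further relators it is asked to contain — here the
route's type-I unit-sign oval identities, integer oval-sector identities and Cauchy relators),
Conjecture 1 on the stratum of KZ-rational representations of dimensions `≤ 2` (`KZDimTwo`,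
stmt-4280) puts `[r] − [r′]` for every equal-valued KZ-rational pair of dimensions `≤ 2` inside
`KZ.relations ≤ R`, and `ReductionToDimensionTwo` (stmt-18030) then puts `ker KZ.eval` inside `R`,
which is `OrientationKernel` at `R`. The three relator hypotheses are carried, not consumed.

`OrientationKernelOfSubs_proof` concludes the route declaration
`Summit.KontsevichZagierPeriods.KontsevichZagierPeriods.Theses.ComplexOrientations.OrientationKernelOfSubs`
by name; `orientationKernel_of_subs` is the same statement unfolded (the `--glue-by` decl of the
recorded edge `route edit --split OrientationKernel --into KZDimTwo ReductionToDimensionTwo`).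
No definitions are introduced. Twin of `Theorems/AbelContractionRealArcKernelSplit.lean`
(`realArcKernel_of_subs`, p148174) and of `Theorems/ComplexOrientationsKernelFormGlue.lean`.

References: M. Kontsevich, D. Zagier, *Periods* (2001), §1.2 Conjecture 1; A. Huber, S. Müller-Stach,
*Periods and Nori Motives* (2017), Conj. 13.2.1 (kernel form of the period conjecture).
-/

namespace Summit.KontsevichZagierPeriods.ComplexOrientations.OrientationKernelOfSubs

open Summit.KontsevichZagierPeriods.KontsevichZagierPeriods.Theses.ComplexOrientations

/-- The split glue, unfolded: `KZDimTwo → ReductionToDimensionTwo → OrientationKernel` (pure logic: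
the stratum feeds the hypothesis of the reduction at the given admissible `R`).
[cite: KontsevichZagier2001, §1.2 Conjecture 1] -/
theorem orientationKernel_of_subs :
    Summit.KontsevichZagierPeriods.KontsevichZagierPeriods.Theses.ComplexOrientations.KZDimTwo →
    Summit.KontsevichZagierPeriods.KontsevichZagierPeriods.Theses.ComplexOrientations.ReductionToDimensionTwo →
    Summit.KontsevichZagierPeriods.KontsevichZagierPeriods.Theses.ComplexOrientations.OrientationKernel :=
  fun h₂ hRed R hR _ _ _ x hx => hRed R hR (fun _ _ hn hm r r' hr hr' hv => hR (h₂ hn hm r r' hr hr' hv)) x hx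

/-- Settles stmt-KontsevichZagierPeriods-18007 (`OrientationKernelOfSubs`), by name. [folklore] -/
theorem OrientationKernelOfSubs_proof :
    Summit.KontsevichZagierPeriods.KontsevichZagierPeriods.Theses.ComplexOrientations.OrientationKernelOfSubs := by
  unfold OrientationKernelOfSubs
  exact orientationKernel_of_subs

end Summit.KontsevichZagierPeriods.ComplexOrientations.OrientationKernelOfSubs
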